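import Literature.Computability.QuantumComplexity.ZXCalculusSwitchDiscard
import Literature.Computability.QuantumComplexity.ZXCalculusDemux
import HarnessLib

/-!
# ZX-calculus: discarding both outputs of the demux

`hd ⨾ (Z^{(1,0)} ⊗ Z^{(1,0)} ⊗ 𝕀) = 𝕀 ⊗ Z^{(1,0)}` (PLAN_N3 law DISC2), from `switch_seq_Z_effect`.
[cite: JeandelPerdrixVilmart2019, §3.1; JeandelPerdrixVilmart2018, Fig. 1 (B1), (K)]
-/

namespace Literature.Computability.QuantumComplexity

open ZXDiagram

namespace ZXClass

/-- **Discarding both outputs of the demux** discards the control: `hd ⨾ (Z^{(1,0)} ⊗ Z^{(1,0)} ⊗ 𝕀) = 𝕀 ⊗ Z^{(1,0)}`. [cite: JeandelPerdrixVilmart2019, §3.1; JeandelPerdrixVilmart2018, Fig. 1 (B1), (K)] -/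
theorem demux_seq_discards : mk demux ⨟ mk (Z 1 0 0) ⊠ (mk (Z 1 0 0) ⊠ mk (wires 1)) = mk (wires 1) ⊠ mk (Z 1 0 0) := by
  have s0 : mk demux ⨟ mk (Z 1 0 0) ⊠ (mk (Z 1 0 0) ⊠ mk (wires 1)) = _ := cgl (show mk demux = mk swap ⨟ mk (Z 1 2 0) ⊠ mk (Z 1 3 0) ⨟ mk (wires 1) ⊠ mk swap ⊠ mk (wires 2) ⨟ mk switch ⊠ (mk (wires 1) ⊠ mk (X 1 1 4) ⨟ mk switch) ⊠ mk (wires 1) from mk_demux) (_ : ZXClass 3 1)  -- mk_demux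
  have s1 := s0.trans ((show mk swap ⨟ mk (Z 1 2 0) ⊠ mk (Z 1 3 0) ⨟ mk (wires 1) ⊠ mk swap ⊠ mk (wires 2) ⨟ mk switch ⊠ (mk (wires 1) ⊠ mk (X 1 1 4) ⨟ mk switch) ⊠ mk (wires 1) ⨟ mk (Z 1 0 0) ⊠ (mk (Z 1 0 0) ⊠ mk (wires 1)) = mk swap ⨟ mk (Z 1 2 0) ⊠ mk (Z 1 3 0) ⨟ mk (wires 1) ⊠ mk swap ⊠ mk (wires 2) ⨟ (mk switch ⊠ (mk (wires 1) ⊠ mk (X 1 1 4) ⨟ mk switch) ⊠ mk (wires 1) ⨟ mk (Z 1 0 0) ⊠ (mk (Z 1 0 0) ⊠ mk (wires 1))) from by simp only [seq_assoc]))  -- assoc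
  have s2 := s1.trans (cgr (_ : ZXClass 2 5) (cgl (show mk switch ⊠ (mk (wires 1) ⊠ mk (X 1 1 4) ⨟ mk switch) ⊠ mk (wires 1) = mk switch ⊠ ((mk (wires 1) ⊠ mk (X 1 1 4) ⨟ mk switch) ⊠ mk (wires 1)) from (par_assoc _ _ _).trans (cast_id _ _ _)) (_ : ZXClass 3 1)))  -- par_assoc
  have s3 := s2.trans (cgr (_ : ZXClass 2 5) (show mk switch ⊠ ((mk (wires 1) ⊠ mk (X 1 1 4) ⨟ mk switch) ⊠ mk (wires 1)) ⨟ mk (Z 1 0 0) ⊠ (mk (Z 1 0 0) ⊠ mk (wires 1)) = (mk switch ⨟ mk (Z 1 0 0)) ⊠ ((mk (wires 1) ⊠ mk (X 1 1 4) ⨟ mk switch) ⊠ mk (wires 1) ⨟ mk (Z 1 0 0) ⊠ mk (wires 1)) from interchange _ _ _ _))  -- interchange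
  have s4 := s3.trans (cgr (_ : ZXClass 2 5) (cpl (show mk switch ⨟ mk (Z 1 0 0) = mk (Z 1 0 0) ⊠ mk (Z 1 0 0) from switch_seq_Z_effect) (_ : ZXClass 3 1)))  -- switch_seq_Z_effect
  have s5 := s4.trans (cgr (_ : ZXClass 2 5) (cpr (_ : ZXClass 2 0) (show (mk (wires 1) ⊠ mk (X 1 1 4) ⨟ mk switch) ⊠ mk (wires 1) ⨟ mk (Z 1 0 0) ⊠ mk (wires 1) = (mk (wires 1) ⊠ mk (X 1 1 4) ⨟ mk switch ⨟ mk (Z 1 0 0)) ⊠ mk (wires 1) from (seq_par_wires _ _ 1).symm)))  -- seq_par_wires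
  have s6 := s5.trans (cgr (_ : ZXClass 2 5) (cpr (_ : ZXClass 2 0) (cpl (show mk (wires 1) ⊠ mk (X 1 1 4) ⨟ mk switch ⨟ mk (Z 1 0 0) = mk (wires 1) ⊠ mk (X 1 1 4) ⨟ (mk switch ⨟ mk (Z 1 0 0)) from by simp only [seq_assoc]) (_ : ZXClass 1 1))))  -- assoc
  have s7 := s6.trans (cgr (_ : ZXClass 2 5) (cpr (_ : ZXClass 2 0) (cpl (cgr (_ : ZXClass 2 2) (show mk switch ⨟ mk (Z 1 0 0) = mk (Z 1 0 0) ⊠ mk (Z 1 0 0) from switch_seq_Z_effect)) (_ : ZXClass 1 1))))  -- switch_seq_Z_effect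
  have s8 := s7.trans (cgr (_ : ZXClass 2 5) (cpr (_ : ZXClass 2 0) (cpl (show mk (wires 1) ⊠ mk (X 1 1 4) ⨟ mk (Z 1 0 0) ⊠ mk (Z 1 0 0) = (mk (wires 1) ⨟ mk (Z 1 0 0)) ⊠ (mk (X 1 1 4) ⨟ mk (Z 1 0 0)) from interchange _ _ _ _) (_ : ZXClass 1 1))))  -- interchange
  have s9 := s8.trans (cgr (_ : ZXClass 2 5) (cpr (_ : ZXClass 2 0) (cpl (cpl (show mk (wires 1) ⨟ mk (Z 1 0 0) = mk (Z 1 0 0) from id_seq _) (_ : ZXClass 1 0)) (_ : ZXClass 1 1))))  -- id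
  have s10 := s9.trans (cgr (_ : ZXClass 2 5) (cpr (_ : ZXClass 2 0) (cpl (cpr (_ : ZXClass 1 0) (show mk (X 1 1 4) ⨟ mk (Z 1 0 0) = mk (Z 1 0 0) from X_phase_pi_seq_Z_effect)) (_ : ZXClass 1 1))))  -- X_phase_pi_seq_Z_effect
  have s11 := s10.trans ((show mk swap ⨟ mk (Z 1 2 0) ⊠ mk (Z 1 3 0) ⨟ mk (wires 1) ⊠ mk swap ⊠ mk (wires 2) ⨟ mk (Z 1 0 0) ⊠ mk (Z 1 0 0) ⊠ (mk (Z 1 0 0) ⊠ mk (Z 1 0 0) ⊠ mk (wires 1)) = mk swap ⨟ mk (Z 1 2 0) ⊠ mk (Z 1 3 0) ⨟ (mk (wires 1) ⊠ mk swap ⊠ mk (wires 2) ⨟ mk (Z 1 0 0) ⊠ mk (Z 1 0 0) ⊠ (mk (Z 1 0 0) ⊠ mk (Z 1 0 0) ⊠ mk (wires 1))) from by simp only [seq_assoc]))  -- assoc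
  have s12 := s11.trans (cgr (_ : ZXClass 2 5) (cgl (show mk (wires 1) ⊠ mk swap ⊠ mk (wires 2) = mk (wires 1) ⊠ (mk swap ⊠ mk (wires 2)) from (par_assoc _ _ _).trans (cast_id _ _ _)) (_ : ZXClass 5 1)))  -- par_assoc
  have s13 := s12.trans (cgr (_ : ZXClass 2 5) (cgr (_ : ZXClass 5 5) (show mk (Z 1 0 0) ⊠ mk (Z 1 0 0) ⊠ (mk (Z 1 0 0) ⊠ mk (Z 1 0 0) ⊠ mk (wires 1)) = mk (Z 1 0 0) ⊠ (mk (Z 1 0 0) ⊠ (mk (Z 1 0 0) ⊠ mk (Z 1 0 0) ⊠ mk (wires 1))) from (par_assoc _ _ _).trans (cast_id _ _ _))))  -- par_assoc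
  have s14 := s13.trans (cgr (_ : ZXClass 2 5) (cgr (_ : ZXClass 5 5) (cpr (_ : ZXClass 1 0) (cpr (_ : ZXClass 1 0) (show mk (Z 1 0 0) ⊠ mk (Z 1 0 0) ⊠ mk (wires 1) = mk (Z 1 0 0) ⊠ (mk (Z 1 0 0) ⊠ mk (wires 1)) from (par_assoc _ _ _).trans (cast_id _ _ _))))))  -- par_assoc
  have s15 := s14.trans (cgr (_ : ZXClass 2 5) (cgr (_ : ZXClass 5 5) (cpr (_ : ZXClass 1 0) (show mk (Z 1 0 0) ⊠ (mk (Z 1 0 0) ⊠ (mk (Z 1 0 0) ⊠ mk (wires 1))) = mk (Z 1 0 0) ⊠ mk (Z 1 0 0) ⊠ (mk (Z 1 0 0) ⊠ mk (wires 1)) from (par_assoc' _ _ _).trans (cast_id _ _ _)))))  -- par_assoc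
  have s16 := s15.trans (cgr (_ : ZXClass 2 5) (show mk (wires 1) ⊠ (mk swap ⊠ mk (wires 2)) ⨟ mk (Z 1 0 0) ⊠ (mk (Z 1 0 0) ⊠ mk (Z 1 0 0) ⊠ (mk (Z 1 0 0) ⊠ mk (wires 1))) = (mk (wires 1) ⨟ mk (Z 1 0 0)) ⊠ (mk swap ⊠ mk (wires 2) ⨟ mk (Z 1 0 0) ⊠ mk (Z 1 0 0) ⊠ (mk (Z 1 0 0) ⊠ mk (wires 1))) from interchange _ _ _ _))  -- interchange
  have s17 := s16.trans (cgr (_ : ZXClass 2 5) (cpl (show mk (wires 1) ⨟ mk (Z 1 0 0) = mk (Z 1 0 0) from (id_seq _)) (_ : ZXClass 4 1)))  -- wire_seq_disc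
  have s18 := s17.trans (cgr (_ : ZXClass 2 5) (cpr (_ : ZXClass 1 0) (show mk swap ⊠ mk (wires 2) ⨟ mk (Z 1 0 0) ⊠ mk (Z 1 0 0) ⊠ (mk (Z 1 0 0) ⊠ mk (wires 1)) = (mk swap ⨟ mk (Z 1 0 0) ⊠ mk (Z 1 0 0)) ⊠ (mk (wires 2) ⨟ mk (Z 1 0 0) ⊠ mk (wires 1)) from interchange _ _ _ _)))  -- interchange
  have s19 := s18.trans (cgr (_ : ZXClass 2 5) (cpr (_ : ZXClass 1 0) (cpr (_ : ZXClass 2 0) (show mk (wires 2) ⨟ mk (Z 1 0 0) ⊠ mk (wires 1) = mk (Z 1 0 0) ⊠ mk (wires 1) from id_seq _))))  -- id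
  have s20 := s19.trans (cgr (_ : ZXClass 2 5) (cpr (_ : ZXClass 1 0) (cpl (cgr (_ : ZXClass 2 2) (show mk (Z 1 0 0) ⊠ mk (Z 1 0 0) = mk (Z 1 0 0) ⊠ mk (wires 1) ⨟ mk (Z 1 0 0) from by rw [par_eq_seq_left (mk (Z 1 0 0)) (mk (Z 1 0 0)), empty_par, cast_id])) (_ : ZXClass 2 1))))  -- effect
  have s21 := s20.trans (cgr (_ : ZXClass 2 5) (cpr (_ : ZXClass 1 0) (cpl (show mk swap ⨟ (mk (Z 1 0 0) ⊠ mk (wires 1) ⨟ mk (Z 1 0 0)) = mk swap ⨟ mk (Z 1 0 0) ⊠ mk (wires 1) ⨟ mk (Z 1 0 0) from by simp only [seq_assoc]) (_ : ZXClass 2 1))))  -- assoc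
  have s22 := s21.trans (cgr (_ : ZXClass 2 5) (cpr (_ : ZXClass 1 0) (cpl (cgl (show mk swap ⨟ mk (Z 1 0 0) ⊠ mk (wires 1) = mk (wires 1) ⊠ mk (Z 1 0 0) from (by have h := congrArg transpose (state_par_seq_swap (mk (Z 0 1 0)) (mk (wires 1))); simpa using h)) (_ : ZXClass 1 0)) (_ : ZXClass 2 1))))  -- swap_seq_disc_par
  have s23 := s22.trans (cgr (_ : ZXClass 2 5) (cpr (_ : ZXClass 1 0) (cpl (show mk (wires 1) ⊠ mk (Z 1 0 0) ⨟ mk (Z 1 0 0) = mk (Z 1 0 0) ⊠ mk (Z 1 0 0) from (by rw [par_eq_seq_right (mk (Z 1 0 0)) (mk (Z 1 0 0)), par_empty] : mk (Z 1 0 0) ⊠ mk (Z 1 0 0) = _).symm) (_ : ZXClass 2 1))))  -- effect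
  have s24 := s23.trans ((show mk swap ⨟ mk (Z 1 2 0) ⊠ mk (Z 1 3 0) ⨟ mk (Z 1 0 0) ⊠ (mk (Z 1 0 0) ⊠ mk (Z 1 0 0) ⊠ (mk (Z 1 0 0) ⊠ mk (wires 1))) = mk swap ⨟ (mk (Z 1 2 0) ⊠ mk (Z 1 3 0) ⨟ mk (Z 1 0 0) ⊠ (mk (Z 1 0 0) ⊠ mk (Z 1 0 0) ⊠ (mk (Z 1 0 0) ⊠ mk (wires 1)))) from by simp only [seq_assoc]))  -- assoc
  have s25 := s24.trans (cgr (_ : ZXClass 2 2) (cgr (_ : ZXClass 2 5) (cpr (_ : ZXClass 1 0) (show mk (Z 1 0 0) ⊠ mk (Z 1 0 0) ⊠ (mk (Z 1 0 0) ⊠ mk (wires 1)) = mk (Z 1 0 0) ⊠ (mk (Z 1 0 0) ⊠ (mk (Z 1 0 0) ⊠ mk (wires 1))) from (par_assoc _ _ _).trans (cast_id _ _ _)))))  -- par_assoc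
  have s26 := s25.trans (cgr (_ : ZXClass 2 2) (cgr (_ : ZXClass 2 5) (show mk (Z 1 0 0) ⊠ (mk (Z 1 0 0) ⊠ (mk (Z 1 0 0) ⊠ (mk (Z 1 0 0) ⊠ mk (wires 1)))) = mk (Z 1 0 0) ⊠ mk (Z 1 0 0) ⊠ (mk (Z 1 0 0) ⊠ (mk (Z 1 0 0) ⊠ mk (wires 1))) from (par_assoc' _ _ _).trans (cast_id _ _ _))))  -- par_assoc
  have s27 := s26.trans (cgr (_ : ZXClass 2 2) (show mk (Z 1 2 0) ⊠ mk (Z 1 3 0) ⨟ mk (Z 1 0 0) ⊠ mk (Z 1 0 0) ⊠ (mk (Z 1 0 0) ⊠ (mk (Z 1 0 0) ⊠ mk (wires 1))) = (mk (Z 1 2 0) ⨟ mk (Z 1 0 0) ⊠ mk (Z 1 0 0)) ⊠ (mk (Z 1 3 0) ⨟ mk (Z 1 0 0) ⊠ (mk (Z 1 0 0) ⊠ mk (wires 1))) from interchange _ _ _ _))  -- interchange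
  have s28 := s27.trans (cgr (_ : ZXClass 2 2) (cpl (cgr (_ : ZXClass 1 2) (show mk (Z 1 0 0) ⊠ mk (Z 1 0 0) = mk (Z 1 0 0) ⊠ mk (wires 1) ⨟ mk (Z 1 0 0) from by rw [par_eq_seq_left (mk (Z 1 0 0)) (mk (Z 1 0 0)), empty_par, cast_id])) (_ : ZXClass 1 1)))  -- effect
  have s29 := s28.trans (cgr (_ : ZXClass 2 2) (cpl (show mk (Z 1 2 0) ⨟ (mk (Z 1 0 0) ⊠ mk (wires 1) ⨟ mk (Z 1 0 0)) = mk (Z 1 2 0) ⨟ mk (Z 1 0 0) ⊠ mk (wires 1) ⨟ mk (Z 1 0 0) from by simp only [seq_assoc]) (_ : ZXClass 1 1)))  -- assoc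
  have s30 := s29.trans (cgr (_ : ZXClass 2 2) (cpl (cgl (show mk (Z 1 2 0) ⨟ mk (Z 1 0 0) ⊠ mk (wires 1) = mk (wires 1) from (by rw [Z_seq_Z_par 1 1 1 0 le_rfl]; exact Z_one_one)) (_ : ZXClass 1 0)) (_ : ZXClass 1 1)))  -- Z12_seq_disc_par
  have s31 := s30.trans (cgr (_ : ZXClass 2 2) (cpl (show mk (wires 1) ⨟ mk (Z 1 0 0) = mk (Z 1 0 0) from (id_seq _)) (_ : ZXClass 1 1)))  -- wire_seq_disc
  have s32 := s31.trans (cgr (_ : ZXClass 2 2) (cpr (_ : ZXClass 1 0) (cgr (_ : ZXClass 1 3) (show mk (Z 1 0 0) ⊠ (mk (Z 1 0 0) ⊠ mk (wires 1)) = mk (Z 1 0 0) ⊠ mk (wires 2) ⨟ mk (Z 1 0 0) ⊠ mk (wires 1) from by rw [par_eq_seq_left (mk (Z 1 0 0)) (mk (Z 1 0 0) ⊠ mk (wires 1)), empty_par, cast_id]))))  -- effect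
  have s33 := s32.trans (cgr (_ : ZXClass 2 2) (cpr (_ : ZXClass 1 0) (show mk (Z 1 3 0) ⨟ (mk (Z 1 0 0) ⊠ mk (wires 2) ⨟ mk (Z 1 0 0) ⊠ mk (wires 1)) = mk (Z 1 3 0) ⨟ mk (Z 1 0 0) ⊠ mk (wires 2) ⨟ mk (Z 1 0 0) ⊠ mk (wires 1) from by simp only [seq_assoc])))  -- assoc
  have s34 := s33.trans (cgr (_ : ZXClass 2 2) (cpr (_ : ZXClass 1 0) (cgl (show mk (Z 1 3 0) ⨟ mk (Z 1 0 0) ⊠ mk (wires 2) = mk (Z 1 2 0) from (Z_seq_Z_par 1 1 2 0 le_rfl 0 0)) (_ : ZXClass 2 1))))  -- Z13_seq_disc_par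
  have s35 := s34.trans (cgr (_ : ZXClass 2 2) (cpr (_ : ZXClass 1 0) (show mk (Z 1 2 0) ⨟ mk (Z 1 0 0) ⊠ mk (wires 1) = mk (wires 1) from (by rw [Z_seq_Z_par 1 1 1 0 le_rfl]; exact Z_one_one))))  -- Z12_seq_disc_par
  have s36 := s35.trans ((show mk swap ⨟ mk (Z 1 0 0) ⊠ mk (wires 1) = mk (wires 1) ⊠ mk (Z 1 0 0) from (by have h := congrArg transpose (state_par_seq_swap (mk (Z 0 1 0)) (mk (wires 1))); simpa using h)))  -- swap_seq_disc_par
  exact s36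


end ZXClass

end Literature.Computability.QuantumComplexity
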